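import Literature.MathematicalPhysics.QuantumFieldTheory.Balaban1983to89.B8SectGH

/-!
# `Balaban1983to89.B8Thm8Surviving` — T. Bałaban, *Spaces of regular gauge field configurations on a lattice and gauge
# fixing conditions*, Commun. Math. Phys. **99** (1985) 75–102 [Balaban1985RegularSpaces] = cell paper B8, Sect. H,
# **Theorem 8** p. 101 at ONE γ in its SURVIVING FORM (cell objection GAPS G-B8-13): the faithful sentence of
# `B8SectGH.Thm8PrintedAt γ` with ONLY the kernel-refuted members of (1.36) made conditional on the inspected source size

statement-level skeleton of published theorems with citation tags; proofs where landed; nothing here is a claim about the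
Yang–Mills mass gap

CITATION HEADER (lean-in-tree rule).  Cell `pub-ymgap` (YM-PLAN Track A, HUMAN RULING D-0062), seat `pub-ymgap-dag-n05-a`
(KNIT-BY-NAME seat of DAG node N05 = [B8]; the typing was put on the cell bus as `B8-RETYPE-PROPOSAL.md` 2026-08-25 and met
«no objection» from the DAG-typing side, dagwriter g79).  PDF held: `paper:balaban1985-cmp99-regular-spaces-gauge-fixing`
(journal page = PDF page + 74); p. 101 [PDF 27] is quoted verbatim in `B8SectGH` (module docstring, WHAT IS PRINTED) and in
`B8.Thm8Inspected`; not re-quoted here beyond the theorem sentence.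

WHAT IS PRINTED (p. 101, verbatim).  *"**Theorem 8.** There exist constants B₁, B₂(β₀), c₁ such that for arbitrary U₀, U′U₀
satisfying (1.33)–(1.35) with α₀ + α₁ ≦ c₁, and for an arbitrary function f from the space R(U₀) satisfying the bound
|f|₍₋₂₎ < γ(α₀ + α₁), there exists exactly one gauge transformation u satisfying (1.29) and such, that the conditions (1.36),
(1.37), (1.39), and (1.146) hold for the configuration U₁ = U′^{u⁻¹}. The constants B₁, B₂(β₀) are as in Theorems 2, 4,
the constant c₁ depends on d, L and γ."*  (Preamble, same page: *"it is enough to assume that |f|₍₋₂₎ < γ(α₀ + α₁) with a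
positive, not too big, constant γ, e.g. γ = 1. Inspecting the proofs of the theorems and propositions we can see easily
that they work in this more general situation almost without any changes, only some constants change their numerical
values."*)

WHY A SURVIVING FORM.  The faithful typing `B8SectGH.Thm8PrintedAt 1 B₁ B₂ fam` (= conjunct `t8` of the DAG leaf
`DagBinding.B8LeafR`) is KERNEL-REFUTED for every `B₁, B₂` on print's admitted flat abelian torus instances
(`B8Thm8FlatAbelianFamily.not_thm8PrintedAt`; U(1)-valued: `B8Thm8U1Family.not_thm8PrintedAt_angle`; cell objection GAPS
G-B8-13: for sources with `|f|₍₋₂₎ < γ(α₀ + α₁)` ONLY, the `∇`- and Hölder members of (1.36) fail `k`-uniformly), hence the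
leaf is false over any gauge-fixing family containing those members (`B8LeafKnit.not_b8LeafR_of_flat_subfamily`) and node
N05 holds there ex falso only.  What SURVIVES — and what the series' only consumer of Theorem 8 uses ([Balaban1985Variational]
(125) p. 297; pub-balaban GAPS G-B11-E3a) — is: the (1.29)-restricted `u` with (1.146), (1.37), the `|A|`-member of (1.36)
(in the (1.62)-shape `C162 B₁`), unique among restricted competitors, and the full (1.36) + (1.39) under the inspected size
`|D^η_{U₀}f|₍₋₃₎ < γ(α₀ + α₁)` (sub-cell b08's reading of «Inspecting the proofs», `B8.Thm8Inspected`,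
`B8SectDSource.thm8_sectD_inspected`; kernel instance at `U₀ = 1` on the `k`-level torus:
`B8Thm8MultiLevelTorus.thm8_multiLevelTorus_V1_surviving` ∕ `_inspected`).

WHAT THIS FILE TYPES AND PROVES (one `def … : Prop`, bookkeeping theorems; 0 sorry).
* `Thm8SurvivingAt γ B₁ B₂ fam` over pv17's faithful carrier `B8SectGH.GFData3`: Theorem 8's sentence AT ONE γ (as
  `Thm8PrintedAt γ`: print's «e.g. γ = 1», the constant `c₁` «depends on d, L and γ») with print's hypotheses (1.33)–(1.35),
  the membership binder `InR U₀ f` («f from the space R(U₀)») and print's size `fNorm f < γ(α₀ + α₁)` VERBATIM, print's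
  UNIQUENESS clause VERBATIM (competitors: restricted `u′` with (1.36), (1.37), (1.39), (1.146)), and in the existence clause
  ONLY the G-B8-13-refuted members made conditional: `C162 B₁` (the `|A|`-member of (1.36)), `C137`, `LandauF` outright;
  `C136 B₁ B₂ ∧ C139 B₁` under `fGrad U₀ f < γ(α₀ + α₁)`.  DIFFERENCES from b08's `B8.Thm8Inspected B₁ B₁′ B₂` (kept, not
  duplicated): (i) ONE γ instead of `∀ γ > 0` with `B₁` fixed before γ — by `B8SectGH.thm8PrintedAt_anti`'s mechanism the
  `∀γ` shape is a statement about arbitrarily LARGE γ at fixed constants (DIVERGENCE D-pv17.3), not print's «not too big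
  … e.g. γ = 1»; (ii) the membership hypothesis `InR` (GAPS G-pv17-3; `GFData3`); (iii) print's WEAKER uniqueness clause
  instead of b08's stronger one (competitors with `C162 B₁′`, `C137`, `LandauF` only).
* `thm8SurvivingAt_of_printedAt` — OLD ⇒ NEW: `Thm8PrintedAt γ B₁ B₂ fam → Thm8SurvivingAt γ B₁ B₂ fam` under the one
  displayed carrier law `C136 b b₂ s ⊂ C162 b s` ((1.62) is the first member of (1.36); `rfl`-true in any honest
  instance) — the `B4LeafNN` ∕ G-ref1-32 pattern «typed ⇒ surviving, never conversely».
* `thm8SurvivingAt_one_of_printed` (from r1's `B8.Thm8Printed`, all γ, at γ = 1), `thm8SurvivingAt_precomp` (sub-families),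
  `thm8SurvivingAt_anti` (antitone in γ: both occurrences of γ strengthen the sentence as γ grows),
  `thm8SurvivingAt_exists` (the existence clause alone, the shape of `B8.thm8_exists_of_printed`'s conclusion plus `InR`).

HONEST SCOPE ∕ NOT CLAIMED.  (i) A TYPING: nothing of Bałaban's is asserted; `Thm8SurvivingAt` is a `Prop` to be used as a
hypothesis (leaf conjunct) or proved on instances; which leaf the DAG binds (`B8LeafR` with `t8 := Thm8PrintedAt 1`, or a
re-typed `B8LeafRS` with `t8 := Thm8SurvivingAt 1`) is the binding owner's decision (dagwriter ∕ NODE 00), not this file's.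
(ii) The surviving form is NOT claimed equivalent to print: it asks LESS of existence (two members of (1.36) and (1.39) only
under the inspected size) and the same of uniqueness; the converse NEW ⇒ OLD is exactly the refuted content.  (iii) The
Hölder member `‖A‖_{1,β}` lives inside the carrier predicate `C136` as in `B8.lean`; (1.147) (printed as unproved, G-B8-09) is
absent as everywhere in the tree.  (iv) One finite four-torus programme at fixed ε, Bałaban AS PRINTED with locators; nothing
continuum ∕ ℝ⁴ ∕ OS ∕ mass gap ∕ Clay.
-/

namespace Literature.MathematicalPhysics.QuantumFieldTheory.Balaban1983to89.B8Thm8Surviving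

variable {I : Type}

/-- **Theorem 8 (p. 101) at ONE γ, SURVIVING FORM** (cell objection GAPS G-B8-13).  Print, verbatim: *"There exist constants
B₁, B₂(β₀), c₁ such that for arbitrary U₀, U′U₀ satisfying (1.33)–(1.35) with α₀ + α₁ ≦ c₁, and for an arbitrary function f
from the space R(U₀) satisfying the bound |f|₍₋₂₎ < γ(α₀ + α₁), there exists exactly one gauge transformation u satisfying
(1.29) and such, that the conditions (1.36), (1.37), (1.39), and (1.146) hold for the configuration U₁ = U′^{u⁻¹}."*
Typed over `B8SectGH.GFData3` exactly as `B8SectGH.Thm8PrintedAt γ B₁ B₂` — hypotheses (1.33)–(1.35) = `InA`, `Reg335`,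
`InAAx`, `avgClose`; membership `InR U₀ f`; size `fNorm f < γ(α₀ + α₁)`; «exactly one … satisfying (1.29)» = `∃ u`,
`Restricted U₀ u`, and every restricted `u′` with (1.36), (1.37), (1.39), (1.146) equals `u` — EXCEPT that in the existence
clause the conclusion is: (1.146) `LandauF`, (1.37) `C137`, the `|A|`-member of (1.36) in the (1.62)-shape `C162 B₁`
OUTRIGHT, and the full (1.36) `C136 B₁ B₂` together with (1.39) `C139 B₁` only UNDER the inspected source size
`fGrad U₀ f < γ(α₀ + α₁)` (`|D^η_{U₀}f|₍₋₃₎`; b08's reading of p. 101 «Inspecting the proofs of the theorems and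
propositions …», `B8.Thm8Inspected`).  The two members so weakened are exactly those refuted `k`-uniformly for
`|f|₍₋₂₎`-small sources (`B8Thm8FlatAbelianFamily.not_thm8PrintedAt`).
[cite: Balaban1985RegularSpaces, Thm 8 (1.146) p.101 (surviving form, GAPS G-B8-13)] -/
def Thm8SurvivingAt (γ B₁ B₂ : ℝ) (fam : I → B8SectGH.GFData3) : Prop :=
  ∃ c₁ : ℝ, 0 < c₁ ∧
    ∀ i : I, ∀ α₀ α₁ : ℝ, 0 < α₀ → 0 < α₁ → α₀ + α₁ ≤ c₁ →
      ∀ U₀ : (fam i).Cfg, ∀ U' : (fam i).Pert, ∀ f : (fam i).Src,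
        (fam i).InA α₀ U₀ → (fam i).Reg335 α₀ U₀ → (fam i).InAAx α₀ U₀ U' → (fam i).avgClose α₁ U₀ U' →
        (fam i).InR U₀ f → (fam i).fNorm f < γ * (α₀ + α₁) →
          ∃ u : (fam i).GT, (fam i).Restricted U₀ u ∧
            ((fam i).C162 B₁ (α₀ + α₁) U₀ ((fam i).act U' u) ∧ (fam i).C137 α₁ U₀ ((fam i).act U' u) ∧
              (fam i).LandauF U₀ f ((fam i).act U' u) ∧
              ((fam i).fGrad U₀ f < γ * (α₀ + α₁) →
                (fam i).C136 B₁ B₂ (α₀ + α₁) U₀ ((fam i).act U' u) ∧ (fam i).C139 B₁ (α₀ + α₁) U₀ ((fam i).act U' u))) ∧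
            ∀ u' : (fam i).GT, (fam i).Restricted U₀ u' →
              (fam i).C136 B₁ B₂ (α₀ + α₁) U₀ ((fam i).act U' u') → (fam i).C137 α₁ U₀ ((fam i).act U' u') →
              (fam i).C139 B₁ (α₀ + α₁) U₀ ((fam i).act U' u') → (fam i).LandauF U₀ f ((fam i).act U' u') → u' = u

/-- **OLD ⇒ NEW** (kernel bookkeeping, the `B4LeafNN` ∕ G-ref1-32 pattern «typed ⇒ surviving, never conversely»): Theorem 8 at
γ AS TYPED (`B8SectGH.Thm8PrintedAt γ`) implies the surviving form with the same constants, under the one displayed carrier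
law `h136_162`: (1.62) `|A| < B₁s(Lʲη)⁻¹` is the first member of (1.36) (`rfl`-true in any honest instance; displayed rather
than built into the carrier, as in `B8.thm8_exists_of_printed`).  The converse is NOT claimed — it is the refuted content
(GAPS G-B8-13). [cite: Balaban1985RegularSpaces, Thm 8 p.101 + (1.36) p.82 + (1.62) p.87 (bookkeeping)] -/
theorem thm8SurvivingAt_of_printedAt (γ B₁ B₂ : ℝ) (fam : I → B8SectGH.GFData3)
    (h136_162 : ∀ i b b₂ s (U₀ : (fam i).Cfg) (U₁ : (fam i).Pert), (fam i).C136 b b₂ s U₀ U₁ → (fam i).C162 b s U₀ U₁)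
    (h : B8SectGH.Thm8PrintedAt γ B₁ B₂ fam) : Thm8SurvivingAt γ B₁ B₂ fam := by
  obtain ⟨c₁, hc₁, H⟩ := h
  refine ⟨c₁, hc₁, fun i α₀ α₁ h0 h1 hs U₀ U' f hA hReg hAx hcl hInR hf => ?_⟩
  obtain ⟨u, hu, ⟨h36, h37, h39, h146⟩, huniq⟩ := H i α₀ α₁ h0 h1 hs U₀ U' f hA hReg hAx hcl hInR hf
  exact ⟨u, hu, ⟨h136_162 i _ _ _ U₀ _ h36, h37, h146, fun _ => ⟨h36, h39⟩⟩, huniq⟩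

/-- The surviving form at print's «e.g. γ = 1» from r1's typing `B8.Thm8Printed` (all γ, no membership binder), under the
carrier law (1.36) ⊂ (1.62) — via `B8SectGH.thm8PrintedAt_one_of_printed`. [cite: Balaban1985RegularSpaces, Thm 8 p.101 (bookkeeping)] -/
theorem thm8SurvivingAt_one_of_printed (B₁ B₂ : ℝ) (fam : I → B8SectGH.GFData3)
    (h136_162 : ∀ i b b₂ s (U₀ : (fam i).Cfg) (U₁ : (fam i).Pert), (fam i).C136 b b₂ s U₀ U₁ → (fam i).C162 b s U₀ U₁)
    (h : B8.Thm8Printed B₁ B₂ (fun i => (fam i).toGFData)) : Thm8SurvivingAt 1 B₁ B₂ fam :=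
  thm8SurvivingAt_of_printedAt 1 B₁ B₂ fam h136_162 (B8SectGH.thm8PrintedAt_one_of_printed B₁ B₂ fam h)

/-- The surviving form for a family gives it for every sub-family (same `γ, B₁, B₂, c₁`). Pure logic (restriction of the
family index). [cite: Balaban1985RegularSpaces, Thm 8 p.101 (bookkeeping: restriction of the family index)] -/
theorem thm8SurvivingAt_precomp {J : Type} (e : J → I) (γ B₁ B₂ : ℝ) (fam : I → B8SectGH.GFData3)
    (h : Thm8SurvivingAt γ B₁ B₂ fam) : Thm8SurvivingAt γ B₁ B₂ (fun j => fam (e j)) := by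
  obtain ⟨c₁, hc₁, H⟩ := h
  exact ⟨c₁, hc₁, fun j => H (e j)⟩

/-- `Thm8SurvivingAt γ` is ANTITONE in γ: a larger γ admits more sources under the size hypothesis AND weakens the
inspected-size premiss of the conditional members, so both occurrences of γ make the sentence stronger (`0 < α₀ + α₁`).
Hence, as for `Thm8PrintedAt` (`B8SectGH.thm8PrintedAt_anti`), a `∀ γ > 0` reading with constants fixed before γ would be
a statement about arbitrarily LARGE γ — the reason the surviving form is typed at ONE γ («e.g. γ = 1»). [cite: Balaban1985RegularSpaces, Thm 8 p.101 («a positive, not too big, constant γ, e.g. γ = 1»; bookkeeping)] -/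
theorem thm8SurvivingAt_anti {γ γ' B₁ B₂ : ℝ} (fam : I → B8SectGH.GFData3) (hle : γ' ≤ γ)
    (h : Thm8SurvivingAt γ B₁ B₂ fam) : Thm8SurvivingAt γ' B₁ B₂ fam := by
  obtain ⟨c₁, hc₁, H⟩ := h
  refine ⟨c₁, hc₁, fun i α₀ α₁ h0 h1 hs U₀ U' f hA hReg hAx hcl hInR hf => ?_⟩
  have hmono : γ' * (α₀ + α₁) ≤ γ * (α₀ + α₁) := mul_le_mul_of_nonneg_right hle (by linarith)
  obtain ⟨u, hu, ⟨h162, h37, h146, hcond⟩, huniq⟩ :=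
    H i α₀ α₁ h0 h1 hs U₀ U' f hA hReg hAx hcl hInR (lt_of_lt_of_le hf hmono)
  exact ⟨u, hu, ⟨h162, h37, h146, fun hg => hcond (lt_of_lt_of_le hg hmono)⟩, huniq⟩

/-- The EXISTENCE clause of the surviving form alone (the shape of `B8.thm8_exists_of_printed`'s conclusion, plus the
membership binder): what every consumer of Theorem 8 in the series reads ([Balaban1985Variational] (125) p. 297 uses the
restricted `u` with (1.146) and the `|A|`-bound). [cite: Balaban1985RegularSpaces, Thm 8 p.101 (bookkeeping)] -/
theorem thm8SurvivingAt_exists {γ B₁ B₂ : ℝ} {fam : I → B8SectGH.GFData3} (h : Thm8SurvivingAt γ B₁ B₂ fam) :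
    ∃ c₁ : ℝ, 0 < c₁ ∧
      ∀ i : I, ∀ α₀ α₁ : ℝ, 0 < α₀ → 0 < α₁ → α₀ + α₁ ≤ c₁ →
        ∀ U₀ : (fam i).Cfg, ∀ U' : (fam i).Pert, ∀ f : (fam i).Src,
          (fam i).InA α₀ U₀ → (fam i).Reg335 α₀ U₀ → (fam i).InAAx α₀ U₀ U' → (fam i).avgClose α₁ U₀ U' →
          (fam i).InR U₀ f → (fam i).fNorm f < γ * (α₀ + α₁) →
            ∃ u : (fam i).GT, (fam i).Restricted U₀ u ∧
              (fam i).C162 B₁ (α₀ + α₁) U₀ ((fam i).act U' u) ∧ (fam i).C137 α₁ U₀ ((fam i).act U' u) ∧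
              (fam i).LandauF U₀ f ((fam i).act U' u) ∧
              ((fam i).fGrad U₀ f < γ * (α₀ + α₁) →
                (fam i).C136 B₁ B₂ (α₀ + α₁) U₀ ((fam i).act U' u) ∧ (fam i).C139 B₁ (α₀ + α₁) U₀ ((fam i).act U' u)) := by
  obtain ⟨c₁, hc₁, H⟩ := h
  refine ⟨c₁, hc₁, fun i α₀ α₁ h0 h1 hs U₀ U' f hA hReg hAx hcl hInR hf => ?_⟩
  obtain ⟨u, hu, ⟨h162, h37, h146, hcond⟩, _⟩ := H i α₀ α₁ h0 h1 hs U₀ U' f hA hReg hAx hcl hInR hf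
  exact ⟨u, hu, h162, h37, h146, hcond⟩

end Literature.MathematicalPhysics.QuantumFieldTheory.Balaban1983to89.B8Thm8Surviving
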